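import Mathlib
import Literature.AlgebraicGeometry.Resolution.FlatSlicingCriterion
import Literature.AlgebraicGeometry.Resolution.RegularLocalRingsQuotient
import Literature.AlgebraicGeometry.Resolution.RegularHomLocalization
import HarnessLib

/-!
# Orders are preserved by flat local homomorphisms with regular closed fibre

Topic: `Literature/AlgebraicGeometry/Resolution`. A lemma behind the "standard arguments" in the
termination proof of Cossart–Piltant 2008, Prop. 4.4 (p. 11: a formal curve along which the order
of `J` stays `μ` must be a branch of `Σ` — transfer of orders between an excellent local ring and
its completion / formal fibres): for a flat local homomorphism `(A, 𝔪) → (B, 𝔫)` of Noetherian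
local rings whose closed fibre `B/𝔪B` is a REGULAR local ring, `𝔫ⁿ ∩ A = 𝔪ⁿ` for all `n`, i.e.
`ord_B(a) = ord_A(a)` for every `a ∈ A` (hence `ord_B(JB) = ord_A(J)`). PROVED:

* `mem_pow_maximalIdeal_iff_of_map_maximalIdeal_eq` — the unramified case `𝔪B = 𝔫` (faithful
  flatness: `𝔪ⁿB ∩ A = 𝔪ⁿ`);
* `mem_pow_maximalIdeal_iff_of_isRegularLocalRing_fiber` — the general case, by induction on the
  dimension of the fibre: cut `B` by a lift `t` of a regular parameter of the fibre; `B/tB` is flat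
  over `A` (Matsumura, Cor. to Thm. 22.5, `FlatSlicingCriterion.lean`) with regular fibre of smaller
  dimension, and `ord_A(a) = ord_{B/tB}(a) ≥ ord_B(a) ≥ ord_A(a)`;
* `map_le_pow_maximalIdeal_iff` — the same for ideals.

## Sources

* H. Matsumura, *Commutative Ring Theory* (1986), §22 (Cor. to Thm. 22.5) and §23. [Matsumura1987]
* V. Cossart, O. Piltant, J. Algebra 320 (2008), proof of Prop. 4.4, p. 11. [CossartPiltant2008]
-/

noncomputable section

open IsLocalRing

namespace Literature.AlgebraicGeometry.Resolution

universe u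

/-! ## The unramified case -/

/-- **`𝔪ⁿB ∩ A = 𝔪ⁿ`** for a faithfully flat `A → B` with `𝔪B = 𝔫`. [cite: Matsumura1987, §22] -/
theorem mem_pow_maximalIdeal_iff_of_map_maximalIdeal_eq {A B : Type*} [CommRing A] [CommRing B]
    [IsLocalRing A] [IsLocalRing B] [Algebra A B] [Module.FaithfullyFlat A B]
    (h : (maximalIdeal A).map (algebraMap A B) = maximalIdeal B) (n : ℕ) (a : A) :
    a ∈ maximalIdeal A ^ n ↔ algebraMap A B a ∈ maximalIdeal B ^ n := by
  rw [← h, ← Ideal.map_pow]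
  constructor
  · exact Ideal.mem_map_of_mem _
  · intro ha
    have := Ideal.mem_comap.mpr ha
    rwa [Ideal.comap_map_eq_self_of_faithfullyFlat] at this

/-! ## The case of a regular closed fibre -/

/-- **`ord_B(a) = ord_A(a)` for a flat local homomorphism with regular closed fibre**: for
`(A, 𝔪) → (B, 𝔫)` flat local with `B/𝔪B` a regular local ring, `a ∈ 𝔪ⁿ ↔ a ∈ 𝔫ⁿ`.
[cite: Matsumura1987, §22 Cor. to Thm. 22.5] [cite: CossartPiltant2008, proof of Prop. 4.4, p. 11] -/
theorem mem_pow_maximalIdeal_iff_of_isRegularLocalRing_fiber {A B : Type u} [CommRing A]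
    [CommRing B] [IsLocalRing A] [IsNoetherianRing A] [IsLocalRing B] [IsNoetherianRing B]
    [Algebra A B] [IsLocalHom (algebraMap A B)] [Module.Flat A B]
    (hreg : IsRegularLocalRing (B ⧸ (maximalIdeal A).map (algebraMap A B))) (n : ℕ) (a : A) :
    a ∈ maximalIdeal A ^ n ↔ algebraMap A B a ∈ maximalIdeal B ^ n := by
  -- induction on the dimension of the fibre
  suffices key : ∀ (e : ℕ) (B : Type u) [CommRing B] [IsLocalRing B] [IsNoetherianRing B]
      [Algebra A B] [IsLocalHom (algebraMap A B)] [Module.Flat A B],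
      IsRegularLocalRing (B ⧸ (maximalIdeal A).map (algebraMap A B)) →
      ringKrullDim (B ⧸ (maximalIdeal A).map (algebraMap A B)) = e →
      ∀ a : A, a ∈ maximalIdeal A ^ n ↔ algebraMap A B a ∈ maximalIdeal B ^ n by
    obtain ⟨e, he⟩ := exists_nat_cast_eq_ringKrullDim
      (R := B ⧸ (maximalIdeal A).map (algebraMap A B))
    exact key e B hreg he a
  intro e
  induction e with
  | zero =>
    intro B _ _ _ _ _ _ hreg hdim a
    -- the fibre is a field, so `𝔪B = 𝔫`
    haveI := hreg
    haveI : IsDomain (B ⧸ (maximalIdeal A).map (algebraMap A B)) := isDomain_of_isRegularLocalRing _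
    haveI : Ring.KrullDimLE 0 (B ⧸ (maximalIdeal A).map (algebraMap A B)) :=
      Ring.krullDimLE_iff.mpr hdim.le
    have hF : IsField (B ⧸ (maximalIdeal A).map (algebraMap A B)) :=
      Ring.KrullDimLE.isField_of_isDomain
    have hbot := IsLocalRing.isField_iff_maximalIdeal_eq.mp hF
    have hmax : (maximalIdeal A).map (algebraMap A B) = maximalIdeal B := by
      refine le_antisymm map_maximalIdeal_le_of_isLocalHom ?_
      have h1 : (maximalIdeal B).map (Ideal.Quotient.mk ((maximalIdeal A).map (algebraMap A B))) =
          ⊥ := by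
        rw [IsLocalRing.map_maximalIdeal_of_surjective _ Ideal.Quotient.mk_surjective]
        exact hbot
      rw [Ideal.map_eq_bot_iff_le_ker, Ideal.mk_ker] at h1
      exact h1
    haveI : Module.FaithfullyFlat A B := Module.FaithfullyFlat.of_flat_of_isLocalHom
    exact mem_pow_maximalIdeal_iff_of_map_maximalIdeal_eq hmax n a
  | succ e ih =>
    intro B _ _ _ _ _ _ hreg hdim a
    haveI := hreg
    set I : Ideal B := (maximalIdeal A).map (algebraMap A B) with hI
    haveI : IsDomain (B ⧸ I) := isDomain_of_isRegularLocalRing _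
    -- a regular parameter `t̄` of the fibre and a lift `t ∈ 𝔫`
    have hne : maximalIdeal (B ⧸ I) ≠ ⊥ := by
      intro hbot
      have hF := IsLocalRing.isField_iff_maximalIdeal_eq.mpr hbot
      have h0 := ringKrullDim_eq_zero_of_isField hF
      rw [hdim] at h0
      exact absurd h0 (by exact_mod_cast Nat.succ_ne_zero e)
    obtain ⟨tb, htb, htb2⟩ : ∃ tb ∈ maximalIdeal (B ⧸ I), tb ∉ maximalIdeal (B ⧸ I) ^ 2 := by
      by_contra hall
      push Not at hall
      apply hne
      refine Submodule.eq_bot_of_le_smul_of_le_jacobson_bot (maximalIdeal (B ⧸ I)) (maximalIdeal (B ⧸ I))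
        (IsNoetherian.noetherian _) ?_ (IsLocalRing.maximalIdeal_le_jacobson _)
      intro x hx
      rw [Ideal.smul_eq_mul, ← sq]
      exact hall x hx
    obtain ⟨t, rfl⟩ := Ideal.Quotient.mk_surjective tb
    have htb0 : Ideal.Quotient.mk I t ≠ 0 := fun h0 => htb2 (h0 ▸ Ideal.zero_mem _)
    have htm : t ∈ maximalIdeal B := by
      by_contra htu
      exact (IsLocalRing.mem_maximalIdeal _).mp htb
        ((not_not.mp ((IsLocalRing.mem_maximalIdeal _).not.mp htu)).map _)
    -- slicing: `t` is `B`-regular and `B₁ = B/tB` is flat over `A`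
    have hfib : IsSMulRegular (B ⧸ I) t := by
      intro b₁ b₂ h
      have h' : Ideal.Quotient.mk I t * b₁ = Ideal.Quotient.mk I t * b₂ := by
        simpa [Algebra.smul_def] using h
      exact mul_left_cancel₀ htb0 h'
    obtain ⟨-, hflat⟩ :=
      Matsumura1987.isSMulRegular_and_flat_quotient_of_isSMulRegular_fiber (A := A) (B := B) hfib
    -- the new ring `B₁ = B/tB`
    have hTtop : Ideal.span {t} ≠ ⊤ := fun h =>
      (IsLocalRing.mem_maximalIdeal _).mp htm (Ideal.span_singleton_eq_top.mp h)
    haveI : Nontrivial (B ⧸ Ideal.span {t}) := Ideal.Quotient.nontrivial_iff.mpr hTtop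
    haveI : IsLocalRing (B ⧸ Ideal.span {t}) :=
      IsLocalRing.of_surjective' (Ideal.Quotient.mk _) Ideal.Quotient.mk_surjective
    haveI : Module.Flat A (B ⧸ Ideal.span {t}) := hflat
    have hmk1 : (maximalIdeal B).map (Ideal.Quotient.mk (Ideal.span {t})) =
        maximalIdeal (B ⧸ Ideal.span {t}) :=
      IsLocalRing.map_maximalIdeal_of_surjective _ Ideal.Quotient.mk_surjective
    haveI : IsLocalHom (algebraMap A (B ⧸ Ideal.span {t})) := by
      refine ⟨fun a ha => ?_⟩
      by_contra hna
      have h1 : algebraMap A B a ∈ maximalIdeal B :=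
        map_maximalIdeal_le_of_isLocalHom (Ideal.mem_map_of_mem _ ((IsLocalRing.mem_maximalIdeal _).mpr hna))
      have h2 : algebraMap A (B ⧸ Ideal.span {t}) a ∈ maximalIdeal (B ⧸ Ideal.span {t}) := by
        rw [← hmk1]
        exact Ideal.mem_map_of_mem _ h1
      exact (IsLocalRing.mem_maximalIdeal _).mp h2 ha
    -- its fibre is `(B/I)/(t̄)`, regular of dimension `e`
    have hI1 : (maximalIdeal A).map (algebraMap A (B ⧸ Ideal.span {t})) =
        I.map (Ideal.Quotient.mk (Ideal.span {t})) := by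
      rw [hI, Ideal.map_map]; rfl
    let e₁ : ((B ⧸ Ideal.span {t}) ⧸ (maximalIdeal A).map (algebraMap A (B ⧸ Ideal.span {t}))) ≃+*
        B ⧸ (Ideal.span {t} ⊔ I) :=
      (Ideal.quotEquivOfEq hI1).trans (DoubleQuot.quotQuotEquivQuotSup (Ideal.span {t}) I)
    let e₂ : ((B ⧸ I) ⧸ Ideal.span {Ideal.Quotient.mk I t}) ≃+* B ⧸ (I ⊔ Ideal.span {t}) := by
      refine (Ideal.quotEquivOfEq ?_).trans (DoubleQuot.quotQuotEquivQuotSup I (Ideal.span {t}))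
      rw [Ideal.map_span, Set.image_singleton]
    let e₃ : ((B ⧸ I) ⧸ Ideal.span {Ideal.Quotient.mk I t}) ≃+*
        ((B ⧸ Ideal.span {t}) ⧸ (maximalIdeal A).map (algebraMap A (B ⧸ Ideal.span {t}))) :=
      (e₂.trans (Ideal.quotEquivOfEq (sup_comm I (Ideal.span {t})))).trans e₁.symm
    obtain ⟨hreg1, hdim1⟩ := IsRegularLocalRing.quotient_span_singleton htb htb2
    haveI := hreg1
    have hreg' : IsRegularLocalRing
        ((B ⧸ Ideal.span {t}) ⧸ (maximalIdeal A).map (algebraMap A (B ⧸ Ideal.span {t}))) :=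
      IsRegularLocalRing.of_ringEquiv e₃
    have hdim' : ringKrullDim
        ((B ⧸ Ideal.span {t}) ⧸ (maximalIdeal A).map (algebraMap A (B ⧸ Ideal.span {t}))) = e := by
      rw [← ringKrullDim_eq_of_ringEquiv e₃]
      obtain ⟨m, hm⟩ := exists_nat_cast_eq_ringKrullDim
        (R := (B ⧸ I) ⧸ Ideal.span {Ideal.Quotient.mk I t})
      rw [hm] at hdim1 ⊢
      rw [hdim] at hdim1
      have : m + 1 = e + 1 := by exact_mod_cast hdim1
      rw [Nat.add_right_cancel this]
    -- induction hypothesis for `A → B₁`, and the sandwich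
    have ih1 := ih (B ⧸ Ideal.span {t}) hreg' hdim' a
    constructor
    · intro ha
      have h1 : algebraMap A B a ∈ ((maximalIdeal A).map (algebraMap A B)) ^ n := by
        rw [← Ideal.map_pow]; exact Ideal.mem_map_of_mem _ ha
      exact Ideal.pow_right_mono (map_maximalIdeal_le_of_isLocalHom (R := A) (S := B)) n h1
    · intro ha
      apply ih1.mpr
      have : algebraMap A (B ⧸ Ideal.span {t}) a =
          Ideal.Quotient.mk (Ideal.span {t}) (algebraMap A B a) := rfl
      rw [this, ← hmk1, ← Ideal.map_pow]
      exact Ideal.mem_map_of_mem _ ha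

/-- The same for ideals: `JB ⊆ 𝔫ⁿ ↔ J ⊆ 𝔪ⁿ`. [cite: Matsumura1987, §22 Cor. to Thm. 22.5] -/
theorem map_le_pow_maximalIdeal_iff_of_isRegularLocalRing_fiber {A B : Type u} [CommRing A]
    [CommRing B] [IsLocalRing A] [IsNoetherianRing A] [IsLocalRing B] [IsNoetherianRing B]
    [Algebra A B] [IsLocalHom (algebraMap A B)] [Module.Flat A B]
    (hreg : IsRegularLocalRing (B ⧸ (maximalIdeal A).map (algebraMap A B))) (n : ℕ)
    (J : Ideal A) : J.map (algebraMap A B) ≤ maximalIdeal B ^ n ↔ J ≤ maximalIdeal A ^ n := by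
  rw [Ideal.map_le_iff_le_comap]
  refine ⟨fun h a ha => ?_, fun h a ha => ?_⟩
  · exact (mem_pow_maximalIdeal_iff_of_isRegularLocalRing_fiber hreg n a).mpr (h ha)
  · exact (mem_pow_maximalIdeal_iff_of_isRegularLocalRing_fiber hreg n a).mp (h ha)

end Literature.AlgebraicGeometry.Resolution

end
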